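import Summits.ValiantsHypothesis.ValiantsHypothesis.Theses.FifoMatching
import Summits.ValiantsHypothesis.ValiantsHypothesis.Theses.DivisionGap
import Literature.Computability.AlgebraicComplexity.NestFreeMatchingPoly

/-!
# Route `FifoMatching`, deciding crux `NNNotVP` (stmt-ValiantsHypothesis-11615) — the glue of the
# division split `ZeroOneTransfer → NNDivisionHard → NNNotVP`

The deciding crux `NNNotVP` (the nest-free = FIFO matching family `NN_n` is not a `VP_ℂ` family;
at least as strong as `ValiantsHypothesis` together with `PerProjectsToNN`) was DECOMPOSED by the
crux strategist (BC2 redirect, 2026-08-17, `Cruxes/NNNotVP/STRATEGY-CENSUS.md` §3e/§5, line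
`Cruxes/NNNotVP/Lines/division_split.lean`) along the division gap of route `DivisionGap`:

  `NNNotVP ⟸ ZeroOneTransfer ∧ NNDivisionHard`.

* `ZeroOneTransfer` — verbatim the route-`DivisionGap` item stmt-ValiantsHypothesis-5066 (one
  shared item, two routes): every `VP_ℂ` family that is the complexification of a family with
  0/1 coefficients has, over `ℝ≥0`, quasi-polynomial subtraction-free complexity WITH ONE
  DIVISION, in the Hrubeš–Yehudayoff normal form `L₊(f_n · h) + L₊(h) ≤ 2^((log₂ n + c)^c)` for
  some nonzero cofactor `h`.
* `NNDivisionHard` (new piece): for every `c`, for all large `n`, every nonzero cofactor `h` has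
  `2^((log₂ n + c)^c) < L₊(NN_n · h) + L₊(h)` (`NN_n` inlined over `ℝ≥0`, exactly as the route
  inlines it over `ℂ`).

This file is the glue ALONE (both hypotheses spelled out verbatim, so that the split children
unfold to them): `nnNotVP_of_subs : ZeroOneTransfer → NNDivisionHard → NNNotVP`, plus the same
statement with the shared hypothesis named as the existing route decl
`Theses.DivisionGap.ZeroOneTransfer` (`nnNotVP_of_zeroOneTransfer`).  Proof: if `NN ∈ VP_ℂ`, the
transfer applied to `NN` over `ℝ≥0` (0/1 coefficients, `coeff_nestFreeMatchingPoly_eq_zero_or_eq_one`;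
complexification `= NN` over `ℂ`, `map_nestFreeMatchingPoly`; the route's inline term is
definitionally the library's `nestFreeMatchingPoly`) bounds its division complexity by
`2^((log₂ n + c)^c)` for all `n`, and hardness at this `c` exceeds it at `n = n₀(c)`.

Honest framing: an implication between OPEN statements; nothing here is progress on `VP ≠ VNP`.
No definitions, no named facts.
-/

noncomputable section

-- Sub = Summit single-conjunct layout: the duplicated namespace component is mandated by the tree.
set_option linter.dupNamespace false

namespace Summit.ValiantsHypothesis.ValiantsHypothesis.Theorems.FifoMatching.NNNotVPSplit

open MvPolynomial Literature.Computability.AlgebraicComplexity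

/-- **The glue of the split: `ZeroOneTransfer → NNDivisionHard → NNNotVP`** (both hypotheses
verbatim the piece statements = the two children of the intended
`ledger route edit route-ValiantsHypothesis-FifoMatching --split NNNotVP`; `h01` is verbatim
`Theses.DivisionGap.ZeroOneTransfer`, item stmt-ValiantsHypothesis-5066).  If `NN ∈ VP_ℂ`, the
transfer applied to `NN` over `ℝ≥0` (0/1 coefficients; complexification `= NN` over `ℂ`) bounds
its division complexity by `2^((log₂ n + c)^c)` for all `n`; hardness at this `c` exceeds it at
`n = n₀`. [folklore] -/
theorem nnNotVP_of_subs
    (h01 : ∀ (σ : ℕ → Type) [∀ n, Fintype (σ n)] (f : ∀ n, MvPolynomial (σ n) NNReal), (∀ n m, MvPolynomial.coeff m (f n) = 0 ∨ MvPolynomial.coeff m (f n) = 1) → Literature.Computability.AlgebraicComplexity.IsVPFamily (k := ℂ) (fun n => MvPolynomial.map (Complex.ofRealHom.comp NNReal.toRealHom) (f n)) → ∃ c : ℕ, ∀ n, ∃ h : MvPolynomial (σ n) NNReal, h ≠ 0 ∧ Literature.Computability.AlgebraicComplexity.complexity (f n * h) + Literature.Computability.AlgebraicComplexity.complexity h ≤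 2 ^ ((Nat.log 2 n + c) ^ c))
    (hNN : ∀ c : ℕ, ∃ n₀ : ℕ, ∀ n ≥ n₀, ∀ h : MvPolynomial (Fin (2 * n) × Fin (2 * n)) NNReal, h ≠ 0 → 2 ^ ((Nat.log 2 n + c) ^ c) < Literature.Computability.AlgebraicComplexity.complexity ((∑ M : Fin (2 * n) → Fin (2 * n), if ((∀ i, M (M i) = i) ∧ (∀ i, M i ≠ i) ∧ ∀ i j, i < j → j < M j → M j < M i → False) then ∏ i : Fin (2 * n), (if i < M i then MvPolynomial.X (i, M i) else 1) else (0 : MvPolynomial (Fin (2 * n) × Fin (2 * n)) NNReal)) * h) + Literature.Computability.AlgebraicComplexity.complexity h) :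
    Summit.ValiantsHypothesis.ValiantsHypothesis.Theses.FifoMatching.NNNotVP := by
  intro hVP
  have hcoeff : ∀ (n : ℕ) (m : (Fin (2 * n) × Fin (2 * n)) →₀ ℕ),
      MvPolynomial.coeff m (nestFreeMatchingPoly n NNReal) = 0 ∨
      MvPolynomial.coeff m (nestFreeMatchingPoly n NNReal) = 1 :=
    fun n m => coeff_nestFreeMatchingPoly_eq_zero_or_eq_one n m
  have hmap : (fun n => MvPolynomial.map (Complex.ofRealHom.comp NNReal.toRealHom)
        (nestFreeMatchingPoly n NNReal)) = fun n => nestFreeMatchingPoly n ℂ := by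
    funext n
    exact map_nestFreeMatchingPoly n _
  have hVP' : IsVPFamily (k := ℂ)
      (fun n => MvPolynomial.map (Complex.ofRealHom.comp NNReal.toRealHom)
        (nestFreeMatchingPoly n NNReal)) := by
    rw [hmap]
    exact hVP
  obtain ⟨c, hc⟩ := h01 (fun n => Fin (2 * n) × Fin (2 * n))
    (fun n => nestFreeMatchingPoly n NNReal) hcoeff hVP'
  obtain ⟨n₀, hn₀⟩ := hNN c
  obtain ⟨h, hh, hle⟩ := hc n₀
  have hlt := hn₀ n₀ le_rfl h hh
  exact absurd (lt_of_lt_of_le hlt hle) (lt_irrefl _)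

/-- The same glue with the shared child named as the EXISTING route decl
`Theses.DivisionGap.ZeroOneTransfer` (item stmt-ValiantsHypothesis-5066 — one item, two routes):
`DivisionGap.ZeroOneTransfer → NNDivisionHard → FifoMatching.NNNotVP`. [folklore] -/
theorem nnNotVP_of_zeroOneTransfer
    (h01 : Summit.ValiantsHypothesis.ValiantsHypothesis.Theses.DivisionGap.ZeroOneTransfer)
    (hNN : ∀ c : ℕ, ∃ n₀ : ℕ, ∀ n ≥ n₀, ∀ h : MvPolynomial (Fin (2 * n) × Fin (2 * n)) NNReal, h ≠ 0 → 2 ^ ((Nat.log 2 n + c) ^ c) < Literature.Computability.AlgebraicComplexity.complexity ((∑ M : Fin (2 * n) → Fin (2 * n), if ((∀ i, M (M i) = i) ∧ (∀ i, M i ≠ i) ∧ ∀ i j, i < j → j < M j → M j < M i → False) then ∏ i : Fin (2 * n), (if i < M i then MvPolynomial.X (i, M i) else 1) else (0 : MvPolynomial (Fin (2 * n) × Fin (2 * n)) NNReal)) * h) + Literature.Computability.AlgebraicComplexity.complexity h) :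
    Summit.ValiantsHypothesis.ValiantsHypothesis.Theses.FifoMatching.NNNotVP :=
  nnNotVP_of_subs h01 hNN

end Summit.ValiantsHypothesis.ValiantsHypothesis.Theorems.FifoMatching.NNNotVPSplit

end
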